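import Mathlib
import HarnessLib
import HarnessLib.Audit
import Summits.ABC.Statement

/-!
Route: RootDecompE

DORMANT since 2026-09-04T07:27:35Z (reconciler: no traction for 5 d (last activity item-evidence-added at 2026-08-30T06:30:18Z); parked, not closed — `ledger route dormant route-ABC-RootDecompE --off` to reactivate) — unstaffed, not closed; items shared with open routes are served there. `ledger route dormant <id> --off` reactivates.

# Route RootDecompE — Root decomposition E (HeckeSignatureFloor, lens 1) — abc splits into a uniform
height floor on the sum-form (2,3,r) cell (exponent ladder r, Hecke sig

It suffices to show X = HeckeFloor ∧ HeckeResidual (root decomposition node of cell decomp-abc, lens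
1 «exponent / quality ladder»,
generation 2; no card realised). Read an abc triple (a, b, c) in SUM FORM of signature (2,3,r): {a,
b} = {x², y³} (an exact square and an
exact cube, either order) and c = C·zʳ with r ≥ 12, z ≥ 2 (the deep member is the largest; C is the
free coefficient). HeckeFloor (P1):
there are s ∈ ℕ and K > 0 such that every such reading of every abc triple has c ≤ K·rad(C)ˢ — a
uniform height floor on the union over
r ≥ 12 of the generalised Fermat families x² + y³ = C zʳ, forgiving the square, the cube and the
base z entirely. HeckeResidual (P2,
DECLARED RESIDUAL): for every (s, K), abc holds on the triples that satisfy the pointwise floor with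
parameters (s, K) (given P1 that is
every triple: S-in-waiting, not a claim of progress). abc ⟹ P1 in the kernel using ONLY ε = 1/12
(node theorem `heckeFloor_of_abc`,
s = 156), abc ⟹ P2 trivially, and P1 → P2 → abc is five lines of logic (`closes`); the AND is exact
(`abc_iff_heckeFloor_and_heckeResidual`).
Lean: `(∃ s : ℕ, ∃ K : ℝ, 0 < K ∧ ∀ a b c : ℕ,
Literature.NumberTheory.DiophantineGeometry.IsABCTriple a b c → ∀ x y z r C : ℕ, 12 ≤ r → 2 ≤ z →
(((a = x ^ 2 ∧ b = y ^ 3) ∨ (a = y ^ 3 ∧ b = x ^ 2)) ∧ c = C * z ^ r) → (c : ℝ) ≤ K *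
((Literature.NumberTheory.DiophantineGeometry.rad C 1 1 : ℕ) : ℝ) ^ s) ∧ (∀ s : ℕ, ∀ K : ℝ, 0 < K →
∀ ε : ℝ, 0 < ε → ∃ C₀ : ℝ, 0 < C₀ ∧ ∀ a b c : ℕ,
Literature.NumberTheory.DiophantineGeometry.IsABCTriple a b c → (∀ x y z r C : ℕ, 12 ≤ r → 2 ≤ z →
(((a = x ^ 2 ∧ b = y ^ 3) ∨ (a = y ^ 3 ∧ b = x ^ 2)) ∧ c = C * z ^ r) → (c : ℝ) ≤ K *
((Literature.NumberTheory.DiophantineGeometry.rad C 1 1 : ℕ) : ℝ) ^ s) → (c : ℝ) < C₀ *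
((Literature.NumberTheory.DiophantineGeometry.rad a b c : ℕ) : ℝ) ^ (1 + ε))`

## Assembly
Pure logic (deciding theorem `closes` in glue.lean, 5 lines): HeckeFloor gives (s, K) such that
EVERY abc triple satisfies the pointwise floor;
HeckeResidual at that (s, K) is abc. The AND is exact (`abc_iff_heckeFloor_and_heckeResidual` in the
node file).

Rationale: WHY THIS LINE. The hyperbolic signatures (2,3,r) (triangle groups Δ(2,3,r) → Δ(2,3,∞) = PSL₂(ℤ)) are
the one column of the Fermat–Catalan table where the
modular method is NOT enough on its own — the Catalan seed 3² − 2³ = 1 and the CM curves j = 0, 1728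
survive level-lowering for every
r — and where the decided cases were won by a second engine: Chabauty–Coleman and elliptic-curve
Chabauty on twists of X(7) (PoonenSchaeferStoll2007),
covers of X(9) and X₀(8)-type curves (Bruin 1999/2003/2005), explicit Chabauty over number fields
(Siksek2013, r = 10), Siksek–Stoll (r = 15),
Selmer-group Chabauty + symplectic criteria (arXiv:1703.05058, r = 11 under GRH, r = 13 partial),
and the reduction of r = 25 to five genus-2
curves (arXiv:2506.10667). abc implies, with one fixed ε, a UNIFORM height floor over this whole
column with coefficients (kernel), and that
floor is the part of abc this engine can see: its C = 1 slice is the asymptotic Fermat–Catalan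
statement for x² + y³ = zʳ whose rungs r = 8,
10, 12, 15 are theorems, r = 11 is a theorem under GRH, and r = 13, 25 are named open cases with
published partial reductions. Imported:
arithmetic geometry of modular-curve twists and p-adic (Chabauty) methods for rational points;
Darmon–Granville finiteness per (C, r) is the
tree fact `darmonGranville1995_thm_2`. What it does that prior routes do not: every Frey-curve route
in the tree is (ℓ,ℓ,ℓ) or (n,n,n)
(LevelLoweredSzpiro, RibetTakahashiSplit, RootDecompB = Kummer level 5, lens-2 FreyLevelDivergence =
Serre level along ℓ → ∞); none cuts abc
along the mixed signature with two exponents frozen at the elliptic orders of PSL₂(ℤ) and one free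
exponent, and none has Chabauty-type
theorems as its decided rungs.
Workshop record (writer decomp-abc-writer-1-g0, cell decomp-abc, LADDER-abc rung 0, D-0178): this is
root node HeckeSignatureFloor of lens 1 (NODE 2026-08-30T02:35:38Z; lens draft file
HeckeSignatureFloor.lean sha256 6704b3e0dae6be6c13f67952f35992028c066d2eacab4814cd506eddde12728a;
NODE-g2.md sha256 b15ae73f8970a14e…), adopted as OR-sibling RootDecompE of the root decomposition;
critic CLEARED decomp-abc-crit-1-g0 2026-08-30T02:47:13Z (HOME/STATUS.md l.132 «CLEARED … lens-1 g2
HeckeSignatureFloor (g2/HeckeSignatureFloor.lean@6704b3e0 …)»; CRITIC-LEDGER row lens-1 g2; gen-0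
QualityWindowLattice OBJECTION 00:5xZ upheld and WITHDRAWN by the lens). Letter E (CLEARED order A
lens-3, B lens-6, C lens-2, D lens-4, E lens-1). abc is NOT proved by anything here — every piece is
open and strictly WEAKER than S (S ⟹ piece in the kernel), the conjunction of the pieces gives S by
`closes`.

RANKED CRUXES. #2 HeckeFloor (crux) — there exist s ∈ ℕ and K > 0 such that for every abc triple
(a,b,c) and every reading {a,b} = {x², y³}, c = C·zʳ with r ≥ 12 and z ≥ 2 one has c ≤ K·rad(C)ˢ
(uniform height floor on the sum-form (2,3,r) cell; WEAKER: abc at ε = 1/12 ⟹ it with s = 156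
(kernel), converse unknown — by exponent typing it only yields polynomial abc with exponent ≥ s/6 on
sub-populations under any genus-0 transfer). [piece P1 (structured side, attacked conjunct) · tag
WEAKER (evidence: S ⟹ P1 kernel `heckeFloor_of_abc` from the SINGLE instance ε = 1/12, s = 156 —
lens file HeckeSignatureFloor.lean sha256 6704b3e0dae6be6c…; critic's re-check xyz ≤ c^{11/12} ⇒
c^{1/144} < K·rad(C)^{13/12}; P1 ⟹ S unknown; EXPONENT-TYPED (fixed s, no ε: T1 n/a) and the cell is
HYPERBOLIC (1/2+1/3+1/r < 1): no non-constant coprime polynomial family x(t)²+y(t)³ = C·z(t)ʳ with z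
non-constant exists (genus > 0) ⇒ vF/T_k costume impossible; the costume-receiving square- /cube-max
arrangements (Klein/Γ₀(4) syzygies, Danilov–Hall) are designed out; BC7/BC2 probes CLEAN); critic
verdict: CLEARED decomp-abc-crit-1-g0 2026-08-30T02:47:13Z · NEC
(abc_iff_heckeFloor_and_heckeResidual) · leaves ATTACKABLE ladder (P1 ⟹ aside SumTail only (r ≥
r₀(K)); the individual SumRung r — no coprime x²+y³ = zʳ, z ≥ 2 — are rungs TOWARD P1's C = 1 fibre,
not consequences of P1 (critic n1): r = 7, 9 FALSE in kernel; 12, 15 and via sumRung_mul 16, 20, 24,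
30, … DECIDED = PRINT; 8, 10 PRINT but BELOW the cell threshold r ≥ 12 (context); 11 under GRH;
first OPEN rungs = asides SumRungThirteen / SumRungTwentyFive with a NAMED road (multi-Frey modular
method + Chabauty: FNS 2020, Freitas–Stoll 2025; 25 sits over the spherical (2,3,5) so is not
reachable by sumRung_mul, critic n4)) + INSTRUMENTABLE (hecke_census.json sha256 79e3068c…:
989/20185 hits have exact □+cube members, 22 sum-form readings r ≥ 12, max log c/log rad C = 10.04 ≪
156) + IDEA-NEEDED top (uniformity in C: Frey–Mazur for E_(x,y) / uniform Chabauty on twists of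
X(r); critic n2 suggests the intermediate rung HeckeFloorSupport S = c bounded on readings with rad
C supported in a fixed finite S, uniform in r ≥ 12 — per fixed (S, r) Darmon–Granville PRINT) +
BARRIER Literature.Barriers.ABC.BakerMethodBounds: rungs OUTSIDE (modularity + Chabauty), floor
beyond the Baker class (declared) · kinship (critic n3): the small-level trivial-solution
obstruction (Catalan 1 + 8 = 9) is shared with RootDecompC's {31} rung] [difficulty: open-problem]
(why it might fail: an infinite family x² + y³ = C zʳ with rad C bounded, r ≥ 12, z ≥ 2 and c → ∞
(none known; per (C,r) finite by Darmon–Granville; the census has max log c/log rad C = 10.04 at 39³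
+ 3229² = 5·2²¹).) [arXiv:1703.05058, arXiv:2506.10667, PoonenSchaeferStoll2007, Siksek2013,
DarmonGranville1995, arXiv:2412.11933]
#3 HeckeResidual (crux) — for every s ∈ ℕ, K > 0 and ε > 0 there is C₀ = C₀(s, K, ε) > 0 such that
every abc triple (a,b,c) which satisfies the pointwise floor «c ≤ K·rad(C)ˢ for every reading {a,b}
= {x², y³}, c = C·zʳ, r ≥ 12, z ≥ 2» obeys c < C₀·rad(abc)^{1+ε} (abc on the triples obeying the
floor; DECLARED RESIDUAL, S-in-waiting: by HeckeFloor the side condition holds for every triple at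
the right (s, K)). [piece P2 · DECLARED RESIDUAL (S-in-waiting, score 0; tolerated under R-EMPTY
because the co-piece P1 passes (a)(b)(c)) · tag WEAKER-formal (S ⟹ P2 kernel; domain ⊇ abc on {a, b
not an exact square/cube pair} ∪ {c 12th-power-free} = density-1 generic bulk; critic found no cheap
transfer INTO «neither summand a square or cube» — role swaps break coprimality/quality — so not
provably COSTUME; T5 acknowledged); critic verdict: CLEARED decomp-abc-crit-1-g0
2026-08-30T02:47:13Z · NEC] [difficulty: open-problem] (why it might fail: cannot fail unless abc
fails (kernel `heckeResidual_of_abc`); as a target it is abc on a family containing every triple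
with 12th-power-free c and, conjecturally, all triples — the residual, no road claimed.)
[arXiv:2412.11933, DarmonGranville1995]
#9 SumRungThirteen (support) — the first open rung of the exponent ladder under HeckeFloor (C = 1
slice, r = 13): no abc triple {a,b} = {x², y³}, c = z¹³ with z ≥ 2, i.e. x² + y³ = z¹³ has no
solution in coprime positive integers (Freitas–Naskręcki–Stoll 2020: the mod-13 representation of
the Frey curve Y² = X³ + 3yX − 2x is irreducible and the CM twists give only trivial solutions;
left: rational points on the remaining twists of X(13)). RUNG = PRINT context: r = 8, 10, 12, 15
decided, r = 11 under GRH, r = 7, 9 FALSE in sum form (kernel `not_sumRung_seven`,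
`not_sumRung_nine`). ASIDE until an in-cone piece imports it. [difficulty: L] [arXiv:1703.05058,
PoonenSchaeferStoll2007]
#9 SumRungTwentyFive (support) — the rung r = 25 (the only composite exponent of the (2,3,·) column
not yet complete): x² + y³ = z²⁵ has no solution in coprime positive integers with z ≥ 2
(Freitas–Stoll 2025, Thm 1.1: holds if the rational points of five explicit genus-2 curves Y² = X⁵ +
A over degree-12 number fields are the expected ones). ASIDE. [difficulty: L] [arXiv:2506.10667,
arXiv:1703.05058]
#9 SumTail (support) — asymptotic Fermat–Catalan for the sum-form (2,3,·) family: there is r₀ such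
that for all r ≥ r₀, x² + y³ = zʳ has no solution in coprime positive integers with z ≥ 2. Kernel:
HeckeFloor ⟹ SumTail (`sumTail_of_heckeFloor`, with C = 1 the floor reads 2ʳ ≤ c ≤ K); composite
rungs reduce to divisors (`sumRung_mul`). ASIDE (the C = 1 shadow of P1; its own top is Darmon's
programme / Frey–Mazur for E_{(x,y)}). [difficulty: open-problem] [arXiv:1703.05058,
arXiv:2412.11933, DarmonGranville1995]

TWO-LAYER PLAN. HeckeFloor ⟹ SumTail ⟹ SumRung r for r ≥ r₀ (kernel), and the rungs SumRung r (C =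
1, one exponent at a time) are the instrument of progress:
r = 8, 10, 12, 15 DECIDED in print, r = 11 under GRH, r = 13 / 25 / 11-unconditional ATTACKABLE NOW,
r = 17, 19, 23 next (FNS recipe: 4–10
twists of X(p) by p mod 24, symplectic criteria, Selmer-group Chabauty). Foreseen split of
HeckeFloor once rungs close: HeckeFloor ⇐
(HeckeFloorSUnit: for every finite set of primes S the readings with rad(C·z) ⊆ S have bounded
height — S-unit (2,3,∞) problems, per (C,r)
= Darmon–Granville) → (HeckeUniformC: the bound is polynomial in rad C uniformly — the
Frey–Mazur-type input, IDEA-NEEDED) → HeckeFloor.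
HeckeResidual: residual, nothing filed.

KILL CRITERIA. Neither crux is refutable without refuting abc (both are kernel consequences of ABC).
The route is retired `superseded` if a route proves
abc on a class containing the whole sum-form (2,3,≥12) cell (then P1 is moot), and `not-a-thesis` if
the critic shows a genus-0 transfer of
degree d with exponent loss < d that maps a co-finite set of triples into the sum-form cell with z ≥
2 (then P1 would be polynomial abc in
disguise — the node's Riemann–Hurwitz count says d ≥ 6 with loss exactly d). SumRungThirteen /
SumRungTwentyFive are refuted by one
coprime solution of x² + y³ = z¹³ (resp. z²⁵) with z ≥ 2 — a certificate checkable by `norm_num`.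

NOT DECOMPOSED YET. The interior of HeckeFloor beyond C = 1 (S-unit slices, uniformity in C), the
modular/Chabauty interior of each rung (irreducibility,
twist lists, Selmer-group Chabauty, the class-group verification that makes r = 11 unconditional),
and the residual's interior (no road
claimed) — layer 2, later. Kernel derivations of SumRung 8 / 10 / 15 from cited complete-solution
theorems would be cite-facts + one-line
support work, not filed.

CHEAPEST FALSIFIER. Is the floor live and is s small on data? Census run locally over the decomp-abc
instrument union of 20 185 known high-merit abc triples
(hecke_census.json sha256 79e3068c486de3fd1557ea95a7bc5cd6a75da4c3e99e19292817e70ec6a7d776): 989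
triples have an exact-square and an
exact-cube member; sum-form readings with r ≥ 7: 71, with r ≥ 12: 22 (z ∈ {2, 3}); max log c / log
rad C = 10.04 (39³ + 3229² = 5·2²¹),
then 6.34 (251² + 55³ = 7·2¹⁵), 5.24 (15³ + 2231² = 19·2¹⁸), 5.09, 5.06; other arrangements r ≥ 7:
229 (max 12.23 at 9·2¹⁵ + 73³ = 827²,
an X₀(4)-type square-max image — excluded from the cell by construction). A family x² + y³ = C·2ʳ
with fixed rad C and r → ∞ kills P1 and
abc together; the kernel refutations 2213459² + 1414³ = 65⁷ and 13² + 7³ = 2⁹ show the ladder's r₀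
is ≥ 10.

NUMBERS. Kernel necessity: ε = 1/12, s = 156, K = K₀(1/12)¹⁴⁴ (from c¹⁴⁴ < K₀¹⁴⁴·rad(C)¹⁵⁶·c¹⁴³);
(xyz)¹² ≤ c¹¹ uses r ≥ 12. Known sum-form solutions
with C = 1, z ≥ 2, r ≥ 7: 2213459² + 1414³ = 65⁷, 15312283² + 9262³ = 113⁷, 13² + 7³ = 2⁹
(arXiv:1703.05058 p.3); none for r = 8, 10, 12, 15
(complete lists). FNS: between four and ten twists of X(p) by p mod 24. Census maxima above; 22
sum-form readings with r ≥ 12 among 20 185 hits.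

DEFINITION REQUESTS. None: the cell predicate is inlined (`((a = x^2 ∧ b = y^3) ∨ (a = y^3 ∧ b =
x^2)) ∧ c = C * z^r` = `IsHeckeShaped` of the node file,
definitionally); `IsABCTriple`, `rad` exist (Literature.NumberTheory.DiophantineGeometry; `rad C 1 1
= radical C`).

Novelty: Searches (2026-08-30): lit search --hybrid "generalized Fermat equation x^2 + y^3 = z^p Frey curve
Chabauty twists" -n 8 ([corpus:arxiv-1703.05058 p.2–5] FNS: known solutions, Thm 1 (r = 11, GRH), p
= 13 partial, Frey curve E_(a,b,c); [corpus:arxiv-2412.11933 p.3–4] survey: (2,3,n) column complete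
except 25 and primes ≥ 11; [corpus:arxiv-2506.10667 p.2] Freitas–Stoll Thm 1.1 (r = 25
conditional)); lit vsearch "uniform bound for the solutions of x^2 + y^3 = C z^n independent of n"
-k 8 (no uniform-in-n height statement; Darmon–Granville per signature); lit galaxy search "Twists
of X(7)" --star pdf ([galaxy:pdf:-7468058809277820180] PSS 2007) and "primitive
solutions|generalized Fermat" --star all ([galaxy:pdf:-9006295786930330340] lecture notes on the
modular method; no floor statement); lit search "signature (2,3,n) abc conjecture implies"
([corpus:arxiv-1811.10118 p.17] abc ⟹ Fermat–Catalan, standard direction only); lean search / rg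
over lean/Summits/ABC and Literature for Hecke|twoThree|FermatCatalan|signature (only
`FermatCatalanConjecture`, `fermatCatalanSolutions`, `darmonGranville1995_thm_2`,
`darmonMerel1997_*`, `SoloBlindFixedSignature`); ledger negatives --problem ABC (no (2,3,r) or
floor-on-signature statement); decomp-abc COSTUME-CENSUS v3 (EQ7/WK8/WK9/RG4: fixed-signature abc
cells and sharp tails are costume via T_k — answered by exponent typing and the sum-form/z ≥ 2 cut).
Nearest prior art found: arXiv:1703.05058 (FNS 2020) §1–2: the (2,3,p) programme with the  [refs: 1703.05058, arxiv-1703.05058, arxiv-2412.11933, arxiv-2506.10667, arxiv-1811.10118, PoonenSchaeferStoll2007, DarmonGranville1995]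

Barriers (technique_class: modular-method, chabauty-twists, gfe-2-3-r, frey-mazur): - technique_class: modular-method, chabauty-twists, gfe-2-3-r, frey-mazur
- Literature.Barriers.ABC.BakerMethodBounds: rungs OUTSIDE — SumRung r is decided by modularity +
level-lowering + Chabauty on twists of X(r), never by linear forms in logarithms; the floor
HeckeFloor as typed (c polynomial in rad C) is beyond the Baker class (Stewart–Yu give
exp(κ·R^{1/3})), which is why its top is declared IDEA-NEEDED (uniform Frey–Mazur / uniform
Darmon–Granville) and not claimed; HeckeResidual keeps 1+ε with an ineffective C₀ and the barrier
does not quantify over it.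
- Literature.Barriers.ABC.EpsilonCannotBeDropped: not touched — HeckeFloor has exponent s ≥ 13 on a
thin cell (no ε-free abc is claimed: rad(C)ˢ with s = 156 is far above c/rad for the Reyssat-type
triples, which are not in the cell anyway), HeckeResidual keeps 1+ε.
- Literature.Barriers.ABC.UniformABCDiscriminantSharp: not touched — everything is over ℚ.
- Literature.Barriers.ABC.ExplicitABCQualityFloor: not touched — no explicit constant; K, s, C₀
existential.
- Literature.Barriers.ABC.IUTDisputedClaim: not cited, not used.
- Genus-0 transfer / costume doctrine of the cell (critic R-EXP, census EQ7/WK8/WK9/RG4; not a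
catalogued barrier): evaded by EXPONENT TYPING — the piece is a floor at a fixed exponent s with no
ε; every identity F² + G³ = H carrying general triples into a (2,3,·) shape has degree d ≥ 6 and d/6
+ 2 distinct factors of H (Riemann–Hurwitz), so the pull-back of the floor is polynomial abc with
expone

History (route lifecycle, newest last):
- 2026-08-30T05:49:26Z · rev 7: restated Assembly (stmt-ABC-26040) — tribunal census-trib-abc-4 (05:39:35Z, verdict E = SPLIT-WITH-RESIDUAL slim pass, applied by operator 05:45:40Z → E OPEN) FLAG (i) for the writer: Assembly item (planner-decomp-abc-writer-1-g3-0)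
- 2026-08-30T21:38:19Z · RESIDUAL declared: KleinCellABC (stmt-ABC-28219) — summit-strength until shown otherwise: gate10 D-0170 bookkeeping: tribunal residual of record payload.tribunal.residual [stmt-ABC-28219]; statement untouched; (planner-decomp-abc-writer-1-g23-0)
- 2026-09-04T07:27:35Z · DORMANT — reconciler: no traction for 5 d (last activity item-evidence-added at 2026-08-30T06:30:18Z); parked, not closed — `ledger route dormant route-ABC-RootDecompE -- (operator:999:2766502)

sub-problem: ABC · status: dormant · opened planner-decomp-abc-writer-1-g0-0 2026-08-30T02:58:36Z · rev 7 · ledger route-ABC-RootDecompE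
GENERATED by the gate from the ledger (D-0016/17). Provers cite these decls: `theorem foo : Summit.ABC.ABC.Theses.RootDecompE.<Decl> := …` in Summits/ABC/ABC/Theorems/<Name>.lean.
-/

namespace Summit.ABC.ABC.Theses.RootDecompE

open scoped BigOperators Topology Manifold Classical MeasureTheory ProbabilityTheory Matrix InnerProductSpace ComplexConjugate ContinuousMap
open Filter Set Function TopologicalSpace MeasureTheory

attribute [summit_statement] _root_.ABC

open Literature.Abc

/-- item stmt-ABC-28218 · crux · leaf IDEA-NEEDED · rank 2 · open · by planner
why it might fail: only if polynomial abc of exponent ~84 fails: an infinite family of coprime twisted Klein points x²u³ + y³v⁴w⁵ = 7-full (level-one members of unbounded height) gives c > K·ℛ⁸⁴ for every K; none known (2 level-one triples below 10¹³; max log c/log ℛ = 22.4 < 42 over 20 185 hits).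
sources: DarmonGranville1995, PoonenSchaeferStoll2007, RibenboimWalsh1999, StewartYu2001, arXiv:math/0508174
[crux · P1 · the DOOR · WEAKER] There is ONE constant K such that EVERY abc triple satisfies c ≤
K·ℛ(a,b,c)^84, where ℛ(a,b,c) = R₂(a)·R₃(b)·R₇(c) and R_k(n) = ∏_{p∣n, v_p(n)<k} p is the conductor
of the failure of the ordered triple to be a (2,3,7)-orbifold (Klein) point: primes where a is not
locally powerful, b not cube-full, c not 7-full (the swapped order is covered since (b,a,c) is also
a triple). Kernel (KleinLevelSplit.lean): PolyABC(84/83) ⟹ KleinFloor ⟹ PolyABC(84) (PolyABC θ: c <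
C·rad^θ), so abc ⟹ KleinFloor via the single instance ε = 1/83 (integer heart rad(abc)^42 ≤
ℛ^42·a^21 b^14 c^6, 1/2+1/3+1/7 = 41/42) and the door is a FIXED-EXPONENT polynomial-abc statement —
strictly weaker than S in the cell's accepted sense (B 23644 / G 27123 precedent), BC2 probe
KleinFloor → ABC FAILS, BC7 CLEAN. It CONTAINS route E's whole signature tower: KleinFloor ⟹
HeckeFloor 26035 with s = 84 (kernel heckeFloor_of_kleinFloor; on a reading {a,b}={x²,y³}, c = C
z^r, r ≥ 7 the level is R₇(C z^r) ≤ rad C). Level ladder: KleinLevelRung M (ℛ ≤ M ⟹ c bounded) for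
all M; bottom KleinLevelOne OPEN (multi-parameter: powerful twists of Darmon–Granville boxes), every
twist box (A x², B y³, C₀ z⁷ -/
@[route_item "route-ABC-RootDecompE"]
def KleinFloor : Prop :=
  ∃ K : ℕ, ∀ a b c : ℕ, Literature.NumberTheory.DiophantineGeometry.IsABCTriple a b c → c ≤ K * ((a.primeFactors.filter (fun p => a.factorization p < 2)).prod (fun p => p) * (b.primeFactors.filter (fun p => b.factorization p < 3)).prod (fun p => p) * (c.primeFactors.filter (fun p => c.factorization p < 7)).prod (fun p => p)) ^ 84

/-- item stmt-ABC-28219 · crux · RESIDUAL (gen 0; summit-strength until shown otherwise, D-0170) · leaf INSTRUMENTABLE · rank 3 · open · by planner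
why it might fail: cannot fail unless abc fails (kernel kleinCellABC_of_abc); in substance it is abc on a cell containing every Klein point and every known hit (λ ≤ 22.4 ≪ 84) — abc minus the door, the declared residual; no road claimed beyond the (2,3,7) Frey/Belyi bounded-conductor home.
sources: RibenboimWalsh1999, StewartYu2001, DarmonGranville1995
[crux · P2 · DECLARED RESIDUAL of the root] abc on the floor cells: for every K and every ε > 0
there is C₀ with c < C₀·rad(abc)^{1+ε} for all abc triples with c ≤ K·ℛ(a,b,c)^84 (∀K is forced: the
door's constant is unknown; ℛ inlined as in KleinFloor). ≡ S modulo KleinFloor (one K₀ covers all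
triples) and DECLARED as such; alone it is not S by any kernel route: BC2 probe KleinCellABC → ABC
FAILS, BC7 CLEAN (P2 hyps consistent, conclusion not free), and it is TRANSPORT-STABLE — a syzygy
image T(a,b,c) = (Φ₁,Φ₂,Φ₃)(a,b) (cube/square maps T_k, β₂, β₃, T₃, φ₂₂ of COSTUME-CENSUS-v4) has c'
≍ c^deg T but lies in the cell only if the non-powerful conductor of the binary-form values Φ_i(a,b)
is ≫ c^{deg T/84}: lower bounds for squarefree kernels / powerful parts of form values are
abc-strength (Ribenboim–Walsh 1999 [corpus:doi-10-1006-jnth-1998-2315]: abc ⟹ such bounds;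
unconditionally none), so no finite set of syzygies pulls the cell back to all triples — exactly the
ruling under which B KummerFloorCell5 23645 and G KummerFloorCell4 27124 PASS as declared residuals,
and the opposite of E rev-2 HeckeResidual (complement of a READING condition, exported by T₃:
TribE.abc_of_heckeResidual). -/
@[route_item "route-ABC-RootDecompE"]
def KleinCellABC : Prop :=
  ∀ K : ℕ, ∀ ε : ℝ, 0 < ε → ∃ C₀ : ℝ, 0 < C₀ ∧ ∀ a b c : ℕ, Literature.NumberTheory.DiophantineGeometry.IsABCTriple a b c → c ≤ K * ((a.primeFactors.filter (fun p => a.factorization p < 2)).prod (fun p => p) * (b.primeFactors.filter (fun p => b.factorization p < 3)).prod (fun p => p) * (c.primeFactors.filter (fun p => c.factorization p < 7)).prod (fun p => p)) ^ 84 → (c : ℝ) < C₀ * ((Literature.NumberTheory.DiophantineGeometry.rad a b c : ℕ) : ℝ) ^ (1 + ε)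

/-- item stmt-ABC-26035 · support · rank 2 · SPLIT (gen 1) into HeckeMordellFloor, HeckePrimeFloor, HeckeSmoothFloor + glue HeckeFloorGlue · direct attempts still welcome (low priority) · by planner
why it might fail: cannot fail unless abc fails (kernel heckeFloor_of_abc); as a target it contains PolyABC-class content on the signature tower (Baker INSIDE on the Mersenne face); rung of the new door
sources: DarmonGranville1995, PoonenSchaeferStoll2007
[crux] there exist s ∈ ℕ and K > 0 such that for every abc triple (a,b,c) and every reading {a,b} =
{x², y³}, c = C·zʳ with r ≥ 12 and z ≥ 2 one has c ≤ K·rad(C)ˢ (uniform height floor on the sum-form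
(2,3,r) cell; WEAKER: abc at ε = 1/12 ⟹ it with s = 156 (kernel), converse unknown — by exponent
typing it only yields polynomial abc with exponent ≥ s/6 on sub-populations under any genus-0
transfer). [piece P1 (structured side, attacked conjunct) · tag WEAKER (evidence: S ⟹ P1 kernel
`heckeFloor_of_abc` from the SINGLE instance ε = 1/12, s = 156 — lens file HeckeSignatureFloor.lean
sha256 6704b3e0dae6be6c…; critic's re-check xyz ≤ c^{11/12} ⇒ c^{1/144} < K·rad(C)^{13/12}; P1 ⟹ S
unknown; EXPONENT-TYPED (fixed s, no ε: T1 n/a) and the cell is HYPERBOLIC (1/2+1/3+1/r < 1): no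
non-constant coprime polynomial family x(t)²+y(t)³ = C·z(t)ʳ with z non-constant exists (genus > 0)
⇒ vF/T_k costume impossible; the costume-receiving square- /cube-max arrangements (Klein/Γ₀(4)
syzygies, Danilov–Hall) are designed out; BC7/BC2 probes CLEAN); critic verdict: CLEARED
decomp-abc-crit-1-g0 2026-08-30T02:47:13Z · NEC (abc_iff_heckeFloor_and_heckeResidual) · leaves
ATTACKABLE ladder (P1 ⟹ aside SumTail -/
@[route_item "route-ABC-RootDecompE"]
def HeckeFloor : Prop :=
  ∃ s : ℕ, ∃ K : ℝ, 0 < K ∧ ∀ a b c : ℕ, Literature.NumberTheory.DiophantineGeometry.IsABCTriple a b c → ∀ x y z r C : ℕ, 12 ≤ r → 2 ≤ z → (((a = x ^ 2 ∧ b = y ^ 3) ∨ (a = y ^ 3 ∧ b = x ^ 2)) ∧ c = C * z ^ r) → (c : ℝ) ≤ K * ((Literature.NumberTheory.DiophantineGeometry.rad C 1 1 : ℕ) : ℝ) ^ s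

-- parent: HeckeFloor · child (gen 1)
/--     item stmt-ABC-26461 · crux · leaf IDEA-NEEDED · rank 201 · open
    parent: HeckeFloor · by planner
    why it might fail: a Mordell curve E_C of positive rank whose EDS carries k-th-power denominators z^k with C·z^{6k} super-polynomial in rad C; excluded per EDS with first term > 1 only in the k-aspect (Reynolds 2012 Thm 1.4), never uniformly in C; EDS with B₁ = 1 (integral points) are untouched.
    sources: arXiv:1101.2949, doi:10.1112/blms/bdm061, DarmonGranville1995
[crux · face M · child of HeckeFloor (P1, lens-1 g2 item of record; birth pending from
g2/route.aside.json)] MORDELL FACE: there are s, K > 0 such that every abc triple {a,b} = {x², y³},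
c = C·z^r with r ≥ 12, z ≥ 2 and 6 ∣ r has c ≤ K·rad(C)^s. Dictionary (kernel
mordell_point_of_reading): r = 6k gives the rational point (X,Y) = (−y/z^{2k}, x/z^{3k}) on the
Mordell curve E_C : Y² = X³ + C with gcd(y,z) = 1, i.e. a power-integral point B_P = z^k, k ≥ 2
(Everest–Reynolds–Stevens). Tags: WEAKER (kernel S ⟹ P1 ⟹ M: heckeFloor_of_abc, faces_of_heckeFloor)
· NEC · ATTACKABLE NOW (rung family MordellColumnBounded C / MordellColumnEmpty C: EDS, primitive
divisors, Klein-form Frey curves + Thue–Mahler — Reynolds 2012 Thm 1.2/1.4, Prop 1.5 (C = 11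
decided: no power-integral points); ERS 2007 Thm 1.1 per fixed k via Faltings; first open rung C =
2, odd multiples of (−1,1) on Y² = X³ + 2) · INSTRUMENTABLE (7 of the 22 census readings; kernel
not_mordellColumnEmpty_three/_seventeen/_nineteen: 11²+23³ = 3·2¹², 541²+206³ = 17·3¹², 2231²+15³ =
19·2¹⁸) · IDEA-NEEDED at the top (uniformity in C = Reynolds Conj 1.6 ⟸ Frey–Mazur, uniformly). File
g3/HeckeDescentSplit.lean. [tag WEAKER (kernel S ⟹ P1 -/
@[route_item "route-ABC-RootDecompE"]
def HeckeMordellFloor : Prop :=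
  ∃ s : ℕ, ∃ K : ℝ, 0 < K ∧ ∀ a b c : ℕ, Literature.NumberTheory.DiophantineGeometry.IsABCTriple a b c → ∀ x y z r C : ℕ, 12 ≤ r → 2 ≤ z → 6 ∣ r → (((a = x ^ 2 ∧ b = y ^ 3) ∨ (a = y ^ 3 ∧ b = x ^ 2)) ∧ c = C * z ^ r) → (c : ℝ) ≤ K * ((Literature.NumberTheory.DiophantineGeometry.rad C 1 1 : ℕ) : ℝ) ^ s

-- parent: HeckeFloor · child (gen 1)
/--     item stmt-ABC-26462 · crux · leaf IDEA-NEEDED · rank 202 · open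
    parent: HeckeFloor · by planner
    why it might fail: it contains the (2,3,p), p → ∞ tail with coefficients: a violating family would live at large prime exponents where only Darmon–Granville finiteness per (C,p) is known; the modular method alone is blocked at every p by the Catalan seed 3² − 2³ = 1 and the CM curves j = 0, 1728.
    sources: arXiv:1703.05058, PoonenSchaeferStoll2007, DarmonGranville1995
[crux · face P · child of HeckeFloor (P1) · residual OF THE SPLIT] PRIME FACE: the same floor on the
readings with 6 ∤ r and a prime p ≥ 7 dividing r; re-read at the prime: x² + y³ = C·(z^{r/p})^p,
Frey curve E_(x,y) : Y² = X³ + 3yX ∓ 2x, level lowering mod p, twists of X(p) (Poonen–Schaefer–Stoll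
2007; Freitas–Naskręcki–Stoll 2020). Tags: WEAKER (kernel) · NEC · rungs DECIDED IN PRINT
(PrimeTower 7 = SumRung 14, 21, 35, … from the complete (2,3,7) list although SumRung 7 is FALSE in
kernel; PrimeTower 11 and SumRung 11 under GRH) · ATTACKABLE rung SumRung 13 (aside of record
SumRungThirteen) · INSTRUMENTABLE (12 of 22 census readings; record log c/log rad C = 10.04 at 3229²
+ 39³ = 5·2²¹) · BARRIER / IDEA-NEEDED at the top: uniformity in p is Darmon's rigidity programme
(Frey–Mazur-type irreducibility, uniform Chabauty on twists of X(p)) — this face carries the whole p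
→ ∞ tail of sum-form Fermat–Catalan with coefficients and is declared the residual of the split, not
progress. [RESIDUAL OF THE SPLIT (all r → ∞ content) · tag WEAKER · NEC · rungs PrimeTower 7 PRINT
(PSS 2007 complete list for x²+y³ = z⁷ — cite the list, SumRung 7 itself is FALSE in kernel), 11 GRH
(FNS 2020), 13 = -/
@[route_item "route-ABC-RootDecompE"]
def HeckePrimeFloor : Prop :=
  ∃ s : ℕ, ∃ K : ℝ, 0 < K ∧ ∀ a b c : ℕ, Literature.NumberTheory.DiophantineGeometry.IsABCTriple a b c → ∀ x y z r C : ℕ, 12 ≤ r → 2 ≤ z → ¬ 6 ∣ r → (∃ p : ℕ, Nat.Prime p ∧ 7 ≤ p ∧ p ∣ r) → (((a = x ^ 2 ∧ b = y ^ 3) ∨ (a = y ^ 3 ∧ b = x ^ 2)) ∧ c = C * z ^ r) → (c : ℝ) ≤ K * ((Literature.NumberTheory.DiophantineGeometry.rad C 1 1 : ℕ) : ℝ) ^ s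

-- parent: HeckeFloor · child (gen 1)
/--     item stmt-ABC-26463 · crux · leaf IDEA-NEEDED · rank 203 · open
    parent: HeckeFloor · by planner
    why it might fail: uniformity in the twist C for the genus ≥ 2 covers of (2,3,8),(2,3,9),(2,3,10),(2,3,15),(2,3,25) needs heights — not just numbers — of rational points bounded polynomially in rad C (Caporaso–Harris–Mazur / uniform Mordell territory); per twist everything is Faltings/DG-finite but ineffective.
    sources: arXiv:2506.10667, arXiv:1703.05058, DarmonGranville1995
[crux · face S · child of HeckeFloor (P1)] SMOOTH FACE: the same floor on the readings whose
exponent r ≥ 12 is 5-smooth and not divisible by 6. Kernel smooth_reduction: such r is divisible by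
one of 8, 9, 10, 15, 25, and heckeSmoothFloor_of_sigFloors: the one-exponent floors SigFloor q at
those FIVE signatures (each a consequence of abc, kernel sigFloor_of_abc with s = 12q) imply S — so
this face has NO r → ∞ content: it is uniformity in the twist C over five fixed generalised Fermat
equations x² + y³ = C·Z^q, q ∈ {8,9,10,15,25}, whose C = 1 fibres are DECIDED IN PRINT (Bruin
1999/2003/2005; Brown 2012, Siksek 2013; Siksek–Stoll 2014) except (2,3,25) (aside of record
SumRungTwentyFive; Freitas–Stoll 2025 Thm 1.1: conditional on five degree-10 equations over sextic
fields, verifiable via rational points of five genus-2 curves Y² = X⁵ + A over degree-12 fields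
[corpus:arxiv-2506.10667 p.3]). Tags: WEAKER (kernel) · NEC · support boxes DECIDED per box mod
darmonGranville1995_thm_2 (kernel supportBox_bounded) · INSTRUMENTABLE (3 census readings, all r =
15: C = 7, 287, 811) · IDEA-NEEDED at the top (uniform Chabauty / uniform Mordell heights for the
twists of five fixed covers). [tag -/
@[route_item "route-ABC-RootDecompE"]
def HeckeSmoothFloor : Prop :=
  ∃ s : ℕ, ∃ K : ℝ, 0 < K ∧ ∀ a b c : ℕ, Literature.NumberTheory.DiophantineGeometry.IsABCTriple a b c → ∀ x y z r C : ℕ, 12 ≤ r → 2 ≤ z → ¬ 6 ∣ r → (∀ p : ℕ, Nat.Prime p → p ∣ r → p ≤ 5) → (((a = x ^ 2 ∧ b = y ^ 3) ∨ (a = y ^ 3 ∧ b = x ^ 2)) ∧ c = C * z ^ r) → (c : ℝ) ≤ K * ((Literature.NumberTheory.DiophantineGeometry.rad C 1 1 : ℕ) : ℝ) ^ s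

-- parent: HeckeFloor · glue (gen 1)
/--     item stmt-ABC-26464 · support · rank 204 · open
    parent: HeckeFloor · GLUE: children ⟹ parent · by planner
HeckeMordellFloor → HeckePrimeFloor → HeckeSmoothFloor → HeckeFloor: decidable face trichotomy of
the exponent r of a reading (6 ∣ r / a prime ≥ 7 divides r / r 5-smooth with 6 ∤ r ⇒ 8∨9∨10∨15∨25 ∣
r) and re-reading at (z^d, r/d); kernel proof in the lens-1 gen-3 file HeckeDescentSplit.lean
(theorem tree_heckeFloor_of_faces against the TREE decl RootDecompE.HeckeFloor, exact
tree_heckeFloor_iff_faces, 0 sorry, std axioms, sha256 ffc7e4eab143f932…; CLEARED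
decomp-abc-crit-1-g0 2026-08-30T03:13:51Z) — a prover lands it under Theorems/ (size S). -/
@[route_item "route-ABC-RootDecompE"]
def HeckeFloorGlue : Prop :=
  HeckeMordellFloor → HeckePrimeFloor → HeckeSmoothFloor → HeckeFloor

/-- item stmt-ABC-26036 · aside · rank 3 · open · by planner
why it might fail: cannot fail unless abc fails (kernel `heckeResidual_of_abc`); as a target it is abc on a family containing every triple with 12th-power-free c and, conjecturally, all triples — the residual, no road claimed.
sources: arXiv:2412.11933, DarmonGranville1995
[crux] for every s ∈ ℕ, K > 0 and ε > 0 there is C₀ = C₀(s, K, ε) > 0 such that every abc triple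
(a,b,c) which satisfies the pointwise floor «c ≤ K·rad(C)ˢ for every reading {a,b} = {x², y³}, c =
C·zʳ, r ≥ 12, z ≥ 2» obeys c < C₀·rad(abc)^{1+ε} (abc on the triples obeying the floor; DECLARED
RESIDUAL, S-in-waiting: by HeckeFloor the side condition holds for every triple at the right (s,
K)). [piece P2 · DECLARED RESIDUAL (S-in-waiting, score 0; tolerated under R-EMPTY because the
co-piece P1 passes (a)(b)(c)) · tag WEAKER-formal (S ⟹ P2 kernel; domain ⊇ abc on {a, b not an exact
square/cube pair} ∪ {c 12th-power-free} = density-1 generic bulk; critic found no cheap transfer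
INTO «neither summand a square or cube» — role swaps break coprimality/quality — so not provably
COSTUME; T5 acknowledged); critic verdict: CLEARED decomp-abc-crit-1-g0 2026-08-30T02:47:13Z · NEC]
[difficulty: open-problem] -/
@[route_item "route-ABC-RootDecompE"]
def HeckeResidual : Prop :=
  ∀ s : ℕ, ∀ K : ℝ, 0 < K → ∀ ε : ℝ, 0 < ε → ∃ C₀ : ℝ, 0 < C₀ ∧ ∀ a b c : ℕ, Literature.NumberTheory.DiophantineGeometry.IsABCTriple a b c → (∀ x y z r C : ℕ, 12 ≤ r → 2 ≤ z → (((a = x ^ 2 ∧ b = y ^ 3) ∨ (a = y ^ 3 ∧ b = x ^ 2)) ∧ c = C * z ^ r) → (c : ℝ) ≤ K * ((Literature.NumberTheory.DiophantineGeometry.rad C 1 1 : ℕ) : ℝ) ^ s) → (c : ℝ) < C₀ * ((Literature.NumberTheory.DiophantineGeometry.rad a b c : ℕ) : ℝ) ^ (1 + ε)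

/-- item stmt-ABC-26037 · aside · rank 9 · open · by planner
sources: arXiv:1703.05058, PoonenSchaeferStoll2007
[aside] the first open rung of the exponent ladder under HeckeFloor (C = 1 slice, r = 13): no abc
triple {a,b} = {x², y³}, c = z¹³ with z ≥ 2, i.e. x² + y³ = z¹³ has no solution in coprime positive
integers (Freitas–Naskręcki–Stoll 2020: the mod-13 representation of the Frey curve Y² = X³ + 3yX −
2x is irreducible and the CM twists give only trivial solutions; left: rational points on the
remaining twists of X(13)). RUNG = PRINT context: r = 8, 10, 12, 15 decided, r = 11 under GRH, r =
7, 9 FALSE in sum form (kernel `not_sumRung_seven`, `not_sumRung_nine`). ASIDE until an in-cone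
piece imports it. [difficulty: L] -/
@[route_item "route-ABC-RootDecompE"]
def SumRungThirteen : Prop :=
  ∀ a b c x y z : ℕ, Literature.NumberTheory.DiophantineGeometry.IsABCTriple a b c → 2 ≤ z → ¬ ((((a = x ^ 2 ∧ b = y ^ 3) ∨ (a = y ^ 3 ∧ b = x ^ 2)) ∧ c = 1 * z ^ 13))

/-- item stmt-ABC-26038 · aside · rank 9 · open · by planner
sources: arXiv:2506.10667, arXiv:1703.05058
[aside] the rung r = 25 (the only composite exponent of the (2,3,·) column not yet complete): x² +
y³ = z²⁵ has no solution in coprime positive integers with z ≥ 2 (Freitas–Stoll 2025, Thm 1.1: holds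
if the rational points of five explicit genus-2 curves Y² = X⁵ + A over degree-12 number fields are
the expected ones). ASIDE. [difficulty: L] -/
@[route_item "route-ABC-RootDecompE"]
def SumRungTwentyFive : Prop :=
  ∀ a b c x y z : ℕ, Literature.NumberTheory.DiophantineGeometry.IsABCTriple a b c → 2 ≤ z → ¬ ((((a = x ^ 2 ∧ b = y ^ 3) ∨ (a = y ^ 3 ∧ b = x ^ 2)) ∧ c = 1 * z ^ 25))

/-- item stmt-ABC-26039 · aside · rank 9 · open · by planner
sources: arXiv:1703.05058, arXiv:2412.11933, DarmonGranville1995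
[aside] asymptotic Fermat–Catalan for the sum-form (2,3,·) family: there is r₀ such that for all r ≥
r₀, x² + y³ = zʳ has no solution in coprime positive integers with z ≥ 2. Kernel: HeckeFloor ⟹
SumTail (`sumTail_of_heckeFloor`, with C = 1 the floor reads 2ʳ ≤ c ≤ K); composite rungs reduce to
divisors (`sumRung_mul`). ASIDE (the C = 1 shadow of P1; its own top is Darmon's programme /
Frey–Mazur for E_{(x,y)}). [difficulty: open-problem] -/
@[route_item "route-ABC-RootDecompE"]
def SumTail : Prop :=
  ∃ r₀ : ℕ, ∀ r : ℕ, r₀ ≤ r → ∀ a b c x y z : ℕ, Literature.NumberTheory.DiophantineGeometry.IsABCTriple a b c → 2 ≤ z → ¬ ((((a = x ^ 2 ∧ b = y ^ 3) ∨ (a = y ^ 3 ∧ b = x ^ 2)) ∧ c = 1 * z ^ r))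

/-- item stmt-ABC-26484 · aside · rank 9 · open · by planner
[aside] first OPEN rung of the Mordell face M = HeckeMordellFloor (lens-1 gen 3, critic n2):
MordellColumnEmpty 2 inlined — no abc triple has a sum-form reading {a,b} = {x², y³}, c = 2·zʳ with
r ≥ 12, z ≥ 2, 6 ∣ r; equivalently no odd multiple n·(−1,1) of the generator of Y² = X³ + 2 (rank 1,
trivial torsion) has EDS denominator B_n a perfect k-th power, k ≥ 2 (power-integral points in the
quadrant X < 0 < Y); no witness below n = 24 (critic/eds_mordell2.py); named road: Reynolds 2012 §4
(even n: 2 = B₂ ∣ B_n, Thm 1.2/1.4 regime) + elliptic Chabauty on the k = 2, 3 covers for odd n (by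
critic n1 the k ∈ {2,3} covers are also what the FACE needs); context: MordellColumnEmpty 1 ⟺ ∀k ≥ 2
SumRung(6k) (kernel, Euler), 11 PRINT (Reynolds 2012 Prop 1.5), 3/17/19 NON-empty in kernel.
ATTACKABLE. critic CLEARED decomp-abc-crit-1-g0 2026-08-30T03:13:51Z (w2). -/
@[route_item "route-ABC-RootDecompE"]
def MordellColumnEmptyTwo : Prop :=
  ∀ a b c x y z r : ℕ, Literature.NumberTheory.DiophantineGeometry.IsABCTriple a b c → 12 ≤ r → 2 ≤ z → 6 ∣ r → ¬ (((a = x ^ 2 ∧ b = y ^ 3) ∨ (a = y ^ 3 ∧ b = x ^ 2)) ∧ c = 2 * z ^ r)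

/-- item stmt-ABC-28220 · aside · rank 9 · open · by planner
why it might fail: an infinite family of coprime twisted Klein points (a powerful, b cube-full, c 7-full) of unbounded height; per twist box bounded mod Darmon–Granville, uniformity open; only 3 members known (13²+7³=2⁹, 2213459²+1414³=65⁷, 15312283²+9262³=113⁷).
sources: DarmonGranville1995, PoonenSchaeferStoll2007, arXiv:math/0508174
[aside · bottom rung of the Klein level ladder · OPEN · abc-true] abc triples of Klein level 1 (a
powerful, b cube-full, c 7-full) have bounded c; conjecturally c ≤ 113⁷. ⟸ KleinFloor (kernel
kleinLevelOne_of_kleinFloor); ⟹ RootDecompE.SumTail 26039 (kernel sumTail_of_kleinLevelOne) and ⟹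
the Fermat–Catalan (2,3,≥7) sum-form corner bounded (kernel cornerFC_of_kleinLevelOne). NOT a finite
union of curves (twists u³, v⁴w⁵ free): per twist box decided mod Darmon–Granville (kernel
twistBox_bounded), uniformly OPEN. Populated by exactly 13²+7³=2⁹ and 2213459²+1414³=65⁷ below 10¹³
(exhaustive census B, klein_census.json) and 15312283²+9262³=113⁷ (kernel isABCTriple_pss113). Why
it might fail: an infinite family of coprime twisted Klein points. [writer decomp-abc-writer-1-g2:
adopted VERBATIM from lens-1 g5 pkg/repair.json (sha16 52413285b3f9fa41; kernel KleinLevelSplit.lean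
sha256 3feddc8d…; NODE-g5.md e09efaac…) as the ROOT REPAIR of route-ABC-RootDecompE after tribunal-2
COSTUME on HeckeResidual 26036; critic verdict cited in the edit note] -/
@[route_item "route-ABC-RootDecompE"]
def KleinLevelOne : Prop :=
  ∃ B : ℕ, ∀ a b c : ℕ, Literature.NumberTheory.DiophantineGeometry.IsABCTriple a b c → (a.primeFactors.filter (fun p => a.factorization p < 2)).prod (fun p => p) * (b.primeFactors.filter (fun p => b.factorization p < 3)).prod (fun p => p) * (c.primeFactors.filter (fun p => c.factorization p < 7)).prod (fun p => p) = 1 → c ≤ B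

/-- item stmt-ABC-28221 · aside · rank 9 · open · by planner
why it might fail: cannot: decided in print (Poonen–Schaefer–Stoll 2007 Thm 1.1, complete list of primitive solutions of x²+y³=z⁷, z ≤ 113 attained); needs a Literature fact item to close by citation.
sources: PoonenSchaeferStoll2007, arXiv:math/0508174
[aside · rung · DECIDED IN PRINT, not in kernel] primitive x² + y³ = z⁷ has z ≤ 113
(Poonen–Schaefer–Stoll 2007, Thm 1.1: the complete list of 16 primitive solutions; the non-trivial
positive ones are 2213459²+1414³=65⁷, 15312283²+9262³=113⁷ and sign variants). Sharpness in kernel: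
sevenBox_sharp (113 attained). A Literature fact item for PSS would let a prover close it by
citation. [writer decomp-abc-writer-1-g2: adopted VERBATIM from lens-1 g5 pkg/repair.json (sha16
52413285b3f9fa41; kernel KleinLevelSplit.lean sha256 3feddc8d…; NODE-g5.md e09efaac…) as the ROOT
REPAIR of route-ABC-RootDecompE after tribunal-2 COSTUME on HeckeResidual 26036; critic verdict
cited in the edit note] -/
@[route_item "route-ABC-RootDecompE"]
def SevenBoxBounded : Prop :=
  ∀ a b c x y z : ℕ, Literature.NumberTheory.DiophantineGeometry.IsABCTriple a b c → a = x ^ 2 → b = y ^ 3 → c = z ^ 7 → z ≤ 113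

-- earlier Assembly (stmt-ABC-26040, replaced 2026-08-30T05:49:26Z -> stmt-ABC-28751): retired by None — HeckeFloor → HeckeResidual → _root_.ABC
/-- item stmt-ABC-28751 · assembly · rank 1 · open · by planner
sources: arXiv:2412.11933
[assembly] KleinFloor → KleinCellABC → ABC (= the deciding theorem `closes` since the root repair
rev 3–6: KleinFloor gives the uniform Klein-level constant K₀ with every abc triple inside the Klein
cell {c ≤ K₀·(Klein level)^84}; KleinCellABC on that cell is abc). Re-rendered by the writer per
tribunal census-trib-abc-4 flag (i) (TRIB-ABC-ROOTDECOMP-4.md, 2026-08-30T05:39:35Z): the rev-2 text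
«HeckeFloor → HeckeResidual → ABC» was STALE (it cited the COSTUME negative edge 26036
HeckeResidual, now an aside outside the cone); provable now by `RootDecompE.closes` (tribunal kernel
TribE4.tree_new_assembly_holds). -/
@[route_item "route-ABC-RootDecompE"]
def Assembly : Prop :=
  KleinFloor → KleinCellABC → _root_.ABC

/-! D-0027 §2.1 — DECIDING THEOREM (planner-authored via `route open/edit --closes-file`; by planner-decomp-abc-writer-1-g2-0 2026-08-30T04:59:52Z):
its hypotheses are this route's items and its conclusion the sub-problem Statement (glue_lint), and it elaborates with this file. -/

@[closes "route-ABC-RootDecompE"] theorem closes (h₁ : KleinFloor) (h₂ : KleinCellABC) : _root_.ABC := by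
  rw [_root_.ABC_iff]
  intro ε hε
  obtain ⟨K, hK⟩ := h₁
  obtain ⟨C₀, hC₀, hb⟩ := h₂ K ε hε
  exact ⟨C₀, hC₀, fun a b c ht => hb a b c ht (hK a b c ht)⟩

end Summit.ABC.ABC.Theses.RootDecompE
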